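import Summits.SmoothPoincare4.SmoothPoincare4.Theorems.SymplecticOrigamiGromovRecognitionRelEndSimpleZeroMoves
import Summits.SmoothPoincare4.SmoothPoincare4.Theorems.SymplecticOrigamiGromovRecognitionRelEndHolCoordCompJHol
import Mathlib.Geometry.Manifold.ContMDiff.NormedSpace

/-!
# The local smooth representative of the retraction onto the sphere at infinity (`U`, `V` charts)
(registered helpers `helper_lamLocalU` and `helper_lamLocalV` of line `cross-cap-laurent`, crux
`GromovRecognitionRelEnd`, item stmt-SmoothPoincare4-11009)

In the glue of the bi-foliation, `(U a, V a)`, `‖a‖ < ε`, is a jointly smooth family of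
`JX`-holomorphic two-chart spheres (the leaves) sweeping the open set
`N = ⋃ a ∈ ball 0 ε, (range (U a) ∪ {V a 0})`, and `π : X → ℂ` is its leaf coordinate (smooth on
`N`, `π (U a z) = a = π (V a w)`).  `T` is a `JX`-holomorphic coordinate on the open set `UT` whose
zero set is the sphere at infinity, and the leaf `a = 0` meets `{T = 0}` at `U 0 z₀`, a SIMPLE zero
of the holomorphic germ `T ∘ U 0` (`deriv (T ∘ U 0) z₀ ≠ 0`).  `helper_lamLocalU` says: near any
point `y₀` of the leaf `0` there are an open `O ∋ y₀` inside `N` and a map `ℓ : X → X`, `C^∞` on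
`O`, with `ℓ y ∈ UT ∩ {T = 0}` on the leaf of `y` (`ℓ y = U (π y) z` for some `z`) and
`ker dℓ_y = ker dπ_y`.  `helper_lamLocalV` is the mirror statement for a simple zero of `T ∘ V 0`
at `w = 0`; both are instances of `LamLocal.exists_local_representative`, stated for one smooth
family `W` (`= U` or `V`).

Proof.  `Φ (a, z) := T (W a z)` is `C^∞` (over `ℝ`) on the open set
`O' = (ball 0 ε ×ˢ univ) ∩ W⁻¹' UT` (composition of `ContMDiffOn` maps, read in the model vector
spaces), `Φ (0, z₀) = 0`, and `fderiv ℝ (Φ (0, ·)) z₀ = fderiv ℝ (T ∘ W 0) z₀` is multiplication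
by the nonzero complex number `deriv (T ∘ W 0) z₀` (`T ∘ W 0` is holomorphic near `z₀` by
`helper_holCoordCompJHol`), hence bijective.  The flat implicit function theorem
`helper_simpleZeroMoves` moves the zero: `ζ` smooth on `‖a‖ < ρ`, `(a, ζ a) ∈ O'`,
`Φ (a, ζ a) = 0`.  Put `O := N ∩ π⁻¹' (ball 0 ρ)` and `ℓ y := W (π y) (ζ (π y)) = (g ∘ π) y`,
`g a := W a (ζ a)`: `ℓ` is smooth on `O` as a composition, takes values in `UT ∩ {T = 0}`, and
`dℓ_y = dg_{π y} ∘ dπ_y` (chain rule) with `dg_a = dW_(a, ζ a) ∘ (id, dζ_a)` injective (the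
differential of the uncurried `W` is injective by hypothesis, and `v ↦ (v, dζ_a v)` is injective),
so `dℓ_y ξ = 0 ↔ dπ_y ξ = 0`.
-/

-- the prescribed namespace `Summit.<P>.<Sub>.…` duplicates `SmoothPoincare4` (P = Sub)
set_option linter.dupNamespace false

open Set Function Literature.Geometry.Symplectic
open scoped Manifold ContDiff Topology

namespace Summit.SmoothPoincare4.SmoothPoincare4.Theorems.GromovRecognitionRelEnd.CrossCapLaurent

namespace LamLocal

/-- **Local smooth representative of the retraction along the leaves onto `{T = 0}`.**  Let
`W : ℂ → ℂ → X` be jointly `C^∞` on `ball 0 ε × ℂ` with injective differentials of the uncurried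
map, `W 0` a `C^∞` `JX`-holomorphic curve, `T : X → ℂ` a `C^∞` `JX`-holomorphic function on the
open set `UT`, `π : X → ℂ` `C^∞` on the open set `N ∋ y₀` with `π y₀ = 0`, and let `T ∘ W 0` have a
simple zero at `z₀` (`W 0 z₀ ∈ UT`, `T (W 0 z₀) = 0`, `deriv (T ∘ W 0) z₀ ≠ 0`).  Then there are an
open `O ∋ y₀` inside `N` and `ℓ : X → X`, `C^∞` on `O`, with `ℓ y ∈ UT`, `T (ℓ y) = 0`,
`ℓ y = W (π y) z` for some `z`, and `dℓ_y ξ = 0 ↔ dπ_y ξ = 0`, for all `y ∈ O`. [folklore] -/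
theorem exists_local_representative {X : Type} [TopologicalSpace X]
    [ChartedSpace (EuclideanSpace ℝ (Fin 4)) X] [IsManifold (𝓡 4) ∞ X]
    (JX : ∀ y : X, TangentSpace (𝓡 4) y →L[ℝ] TangentSpace (𝓡 4) y) {T : X → ℂ} {UT : Set X}
    {ε : ℝ} {W : ℂ → ℂ → X} {π : X → ℂ} {N : Set X} {y₀ : X} {z₀ : ℂ}
    (hUT : IsOpen UT) (hT : ContMDiffOn (𝓡 4) 𝓘(ℝ, ℂ) ∞ T UT)
    (hTJ : ∀ y ∈ UT, ∀ w : TangentSpace (𝓡 4) y,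
      (show ℂ from mfderiv (𝓡 4) 𝓘(ℝ, ℂ) T y (JX y w)) =
        Complex.I * (show ℂ from mfderiv (𝓡 4) 𝓘(ℝ, ℂ) T y w))
    (hε : 0 < ε) (hW0 : ContMDiff 𝓘(ℝ, ℂ) (𝓡 4) ∞ (W 0)) (hW0J : IsJHolomorphic (𝓡 4) JX (W 0))
    (hWs : ContMDiffOn 𝓘(ℝ, ℂ × ℂ) (𝓡 4) ∞ (fun q : ℂ × ℂ => W q.1 q.2)
      (Metric.ball 0 ε ×ˢ univ))
    (hWinj : ∀ q ∈ Metric.ball (0 : ℂ) ε ×ˢ (univ : Set ℂ),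
      Injective (mfderiv 𝓘(ℝ, ℂ × ℂ) (𝓡 4) (fun q : ℂ × ℂ => W q.1 q.2) q))
    (hN : IsOpen N) (hπ : ContMDiffOn (𝓡 4) 𝓘(ℝ, ℂ) ∞ π N) (hy₀N : y₀ ∈ N) (hπy₀ : π y₀ = 0)
    (hz₀ : W 0 z₀ ∈ UT) (hT0 : T (W 0 z₀) = 0) (hderiv : deriv (T ∘ W 0) z₀ ≠ 0) :
    ∃ (O : Set X) (ℓ : X → X), IsOpen O ∧ y₀ ∈ O ∧ O ⊆ N ∧
      ContMDiffOn (𝓡 4) (𝓡 4) ∞ ℓ O ∧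
      (∀ y ∈ O, ℓ y ∈ UT ∧ T (ℓ y) = 0 ∧ ∃ z : ℂ, ℓ y = W (π y) z) ∧
      (∀ y ∈ O, ∀ ξ : TangentSpace (𝓡 4) y,
        mfderiv (𝓡 4) (𝓡 4) ℓ y ξ = 0 ↔ mfderiv (𝓡 4) 𝓘(ℝ, ℂ) π y ξ = 0) := by
  -- the parameter domain `s = ball 0 ε × ℂ` and the domain `O' = s ∩ W⁻¹' UT` of `Φ = T ∘ W`
  have hs : IsOpen (Metric.ball (0 : ℂ) ε ×ˢ (univ : Set ℂ)) := Metric.isOpen_ball.prod isOpen_univ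
  have hO' : IsOpen (Metric.ball (0 : ℂ) ε ×ˢ (univ : Set ℂ) ∩
      (fun q : ℂ × ℂ => W q.1 q.2) ⁻¹' UT) :=
    hWs.continuousOn.isOpen_inter_preimage hs hUT
  have hmemO' : ((0 : ℂ), z₀) ∈ Metric.ball (0 : ℂ) ε ×ˢ (univ : Set ℂ) ∩
      (fun q : ℂ × ℂ => W q.1 q.2) ⁻¹' UT :=
    ⟨⟨Metric.mem_ball_self hε, mem_univ _⟩, hz₀⟩
  -- `Φ` is smooth over `ℝ` on `O'`
  have hΦ : ContDiffOn ℝ ∞ (T ∘ fun q : ℂ × ℂ => W q.1 q.2)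
      (Metric.ball (0 : ℂ) ε ×ˢ (univ : Set ℂ) ∩ (fun q : ℂ × ℂ => W q.1 q.2) ⁻¹' UT) :=
    contMDiffOn_iff_contDiffOn.1 (hT.comp' hWs)
  -- its partial derivative in `z` at `(0, z₀)` is multiplication by `deriv (T ∘ W 0) z₀ ≠ 0`
  have hbij : Bijective (fderiv ℝ (T ∘ W 0) z₀) := by
    have hopen : IsOpen ((W 0) ⁻¹' UT) := hUT.preimage hW0.continuous
    have hd : DifferentiableAt ℂ (T ∘ W 0) z₀ :=
      (helper_holCoordCompJHol X JX T UT (W 0) hUT hT hTJ hW0 hW0J).differentiableAt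
        (hopen.mem_nhds hz₀)
    rw [hd.hasDerivAt.complexToReal_fderiv.fderiv]
    constructor
    · intro v w hvw
      have h : deriv (T ∘ W 0) z₀ * v = deriv (T ∘ W 0) z₀ * w := by simpa using hvw
      exact mul_left_cancel₀ hderiv h
    · intro w
      exact ⟨(deriv (T ∘ W 0) z₀)⁻¹ * w, by simp [hderiv]⟩
  -- the implicit function theorem moves the simple zero smoothly with the parameter
  obtain ⟨ζ, ρ, r, hρ, -, -, hζ, hgraph, -⟩ :=
    helper_simpleZeroMoves (T ∘ fun q : ℂ × ℂ => W q.1 q.2) z₀ _ hO' hmemO' hΦ hT0 hbij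
  -- the open set `O = N ∩ π⁻¹' (ball 0 ρ)` and `ℓ y = W (π y) (ζ (π y))`
  refine ⟨N ∩ π ⁻¹' Metric.ball 0 ρ, fun y => W (π y) (ζ (π y)),
    hπ.continuousOn.isOpen_inter_preimage hN Metric.isOpen_ball, ⟨hy₀N, ?_⟩, inter_subset_left,
    ?_, ?_, ?_⟩
  · -- `y₀ ∈ O`
    rw [mem_preimage, hπy₀]
    exact Metric.mem_ball_self hρ
  · -- smoothness: `ℓ = W ∘ (id, ζ) ∘ π`
    have hG : ContMDiffOn 𝓘(ℝ, ℂ) 𝓘(ℝ, ℂ × ℂ) ∞ (fun a : ℂ => (a, ζ a)) (Metric.ball 0 ρ) :=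
      contMDiffOn_iff_contDiffOn.2 (contDiffOn_id.prodMk hζ)
    have hg : ContMDiffOn 𝓘(ℝ, ℂ) (𝓡 4) ∞
        ((fun q : ℂ × ℂ => W q.1 q.2) ∘ fun a : ℂ => (a, ζ a)) (Metric.ball 0 ρ) :=
      hWs.comp hG fun a ha => (hgraph a (mem_ball_zero_iff.1 ha)).1.1
    exact hg.comp (hπ.mono inter_subset_left) fun y hy => hy.2
  · -- values in `UT ∩ {T = 0}`, on the leaf of `y`
    intro y hy
    obtain ⟨hmem, -, hzero⟩ := hgraph (π y) (mem_ball_zero_iff.1 hy.2)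
    exact ⟨hmem.2, hzero, ζ (π y), rfl⟩
  · -- kernel of `dℓ`
    intro y hy ξ
    have ha : ‖π y‖ < ρ := mem_ball_zero_iff.1 hy.2
    have hq : (π y, ζ (π y)) ∈ Metric.ball (0 : ℂ) ε ×ˢ (univ : Set ℂ) := (hgraph (π y) ha).1.1
    have hπd : MDifferentiableAt (𝓡 4) 𝓘(ℝ, ℂ) π y :=
      (hπ.contMDiffAt (hN.mem_nhds hy.1)).mdifferentiableAt (by simp)
    have hFd : MDifferentiableAt 𝓘(ℝ, ℂ × ℂ) (𝓡 4) (fun q : ℂ × ℂ => W q.1 q.2) (π y, ζ (π y)) :=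
      (hWs.contMDiffAt (hs.mem_nhds hq)).mdifferentiableAt (by simp)
    have hζd : DifferentiableAt ℝ ζ (π y) :=
      (hζ.contDiffAt (Metric.isOpen_ball.mem_nhds (mem_ball_zero_iff.2 ha))).differentiableAt
        (by simp)
    have hGd : HasMFDerivAt 𝓘(ℝ, ℂ) 𝓘(ℝ, ℂ × ℂ) (fun a : ℂ => (a, ζ a)) (π y)
        ((ContinuousLinearMap.id ℝ ℂ).prod (fderiv ℝ ζ (π y))) :=
      ((hasFDerivAt_id (π y)).prodMk hζd.hasFDerivAt).hasMFDerivAt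
    have hchain : HasMFDerivAt (𝓡 4) (𝓡 4) (fun y => W (π y) (ζ (π y))) y
        (((mfderiv 𝓘(ℝ, ℂ × ℂ) (𝓡 4) (fun q : ℂ × ℂ => W q.1 q.2) (π y, ζ (π y))).comp
          ((ContinuousLinearMap.id ℝ ℂ).prod (fderiv ℝ ζ (π y)))).comp
          (mfderiv (𝓡 4) 𝓘(ℝ, ℂ) π y)) :=
      (hFd.hasMFDerivAt.comp (π y) hGd).comp y hπd.hasMFDerivAt
    -- `dℓ_y ξ = dW_(π y, ζ (π y)) (v, dζ v)` with `v = dπ_y ξ` (chain rule)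
    have hval : mfderiv (𝓡 4) (𝓡 4) (fun y => W (π y) (ζ (π y))) y ξ =
        mfderiv 𝓘(ℝ, ℂ × ℂ) (𝓡 4) (fun q : ℂ × ℂ => W q.1 q.2) (π y, ζ (π y))
          ((mfderiv (𝓡 4) 𝓘(ℝ, ℂ) π y ξ,
            fderiv ℝ ζ (π y) (mfderiv (𝓡 4) 𝓘(ℝ, ℂ) π y ξ)) : ℂ × ℂ) :=
      DFunLike.congr_fun hchain.mfderiv ξ
    show mfderiv (𝓡 4) (𝓡 4) (fun y => W (π y) (ζ (π y))) y ξ = 0 ↔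
      mfderiv (𝓡 4) 𝓘(ℝ, ℂ) π y ξ = 0
    rw [hval]
    constructor
    · intro h
      have h2 : ((mfderiv (𝓡 4) 𝓘(ℝ, ℂ) π y ξ,
          fderiv ℝ ζ (π y) (mfderiv (𝓡 4) 𝓘(ℝ, ℂ) π y ξ)) : ℂ × ℂ) = 0 :=
        hWinj _ hq (h.trans (map_zero _).symm)
      exact (Prod.mk_eq_zero.1 h2).1
    · intro h
      have h2 : ((mfderiv (𝓡 4) 𝓘(ℝ, ℂ) π y ξ,
          fderiv ℝ ζ (π y) (mfderiv (𝓡 4) 𝓘(ℝ, ℂ) π y ξ)) : ℂ × ℂ) = 0 :=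
        Prod.ext h (by rw [h]; exact map_zero _)
      rw [h2]
      exact map_zero _

end LamLocal

/-- **Local smooth representative of the retraction `lam`, `U`-chart.**  With the leaf
coordinate `π` of the family `(U a, V a)`, `‖a‖ < ε`, of `JX`-holomorphic two-chart spheres
sweeping `N = ⋃ a ∈ ball 0 ε, (range (U a) ∪ {V a 0})`, a `JX`-holomorphic coordinate `T` on the
open set `UT`, and a simple zero `z₀` of `T ∘ U 0` with `U 0 z₀ ∈ UT`: near every point `y₀` of the
leaf `0` there are an open `O ∋ y₀`, `O ⊆ N`, and `ℓ : X → X` smooth on `O` with `ℓ y ∈ UT`,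
`T (ℓ y) = 0`, `ℓ y = U (π y) z` for some `z`, and `dℓ_y ξ = 0 ↔ dπ_y ξ = 0`. -/
theorem helper_lamLocalU : ∀ (X : Type) [TopologicalSpace X] [T2Space X] [SecondCountableTopology X] [ChartedSpace (EuclideanSpace ℝ (Fin 4)) X] [IsManifold (𝓡 4) ∞ X] (JX : ∀ y : X, TangentSpace (𝓡 4) y →L[ℝ] TangentSpace (𝓡 4) y) (T : X → ℂ) (UT : Set X) (ε : ℝ) (U V : ℂ → ℂ → X) (π : X → ℂ) (y₀ : X) (z₀ : ℂ), IsOpen UT → ContMDiffOn (𝓡 4) 𝓘(ℝ, ℂ) ∞ T UT → (∀ y ∈ UT, ∀ w : TangentSpace (𝓡 4) y, (show ℂ from mfderiv (𝓡 4) 𝓘(ℝ, ℂ) T y (JX y w)) = Complex.I * (show ℂ from mfderiv (𝓡 4) 𝓘(ℝ, ℂ) T y w)) → 0 < ε → (∀ a : ℂ, ‖a‖ < ε → ContMDiff 𝓘(ℝ, ℂ) (𝓡 4) ∞ (U a) ∧ IsJHolomorphic (𝓡 4) JX (U a)) → ContMDiffOn 𝓘(ℝ, ℂ × ℂ) (𝓡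 4) ∞ (fun q : ℂ × ℂ => U q.1 q.2) (Metric.ball 0 ε ×ˢ univ) → (∀ q ∈ Metric.ball (0 : ℂ) ε ×ˢ (univ : Set ℂ), Injective (mfderiv 𝓘(ℝ, ℂ × ℂ) (𝓡 4) (fun q : ℂ × ℂ => U q.1 q.2) q)) → IsOpen (⋃ a ∈ Metric.ball (0 : ℂ) ε, (range (U a) ∪ {V a 0})) → ContMDiffOn (𝓡 4) 𝓘(ℝ, ℂ) ∞ π (⋃ a ∈ Metric.ball (0 : ℂ) ε, (range (U a) ∪ {V a 0})) → (∀ y ∈ ⋃ a ∈ Metric.ball (0 : ℂ) ε, (range (U a) ∪ {V a 0}), Surjective (mfderiv (𝓡 4) 𝓘(ℝ, ℂ) π y)) → (∀ a : ℂ, ‖a‖ < ε → ∀ z : ℂ, π (U a z) = a) → (∀ a : ℂ, ‖a‖ < ε → ∀ w : ℂ, π (V a w) = a) → (∀ y ∈ ⋃ a ∈ Metric.ball (0 : ℂ) ε, (range (U a) ∪ {V a 0}), ‖π y‖ < ε) → y₀ ∈ range (U 0) ∪ {V 0 0} → U 0 z₀ ∈ UT → T (U 0 z₀) = 0 → deriv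 (T ∘ U 0) z₀ ≠ 0 → ∃ (O : Set X) (ℓ : X → X), IsOpen O ∧ y₀ ∈ O ∧ O ⊆ (⋃ a ∈ Metric.ball (0 : ℂ) ε, (range (U a) ∪ {V a 0})) ∧ ContMDiffOn (𝓡 4) (𝓡 4) ∞ ℓ O ∧ (∀ y ∈ O, ℓ y ∈ UT ∧ T (ℓ y) = 0 ∧ ∃ z : ℂ, ℓ y = U (π y) z) ∧ (∀ y ∈ O, ∀ ξ : TangentSpace (𝓡 4) y, mfderiv (𝓡 4) (𝓡 4) ℓ y ξ = 0 ↔ mfderiv (𝓡 4) 𝓘(ℝ, ℂ) π y ξ = 0) := by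
  intro X _ _ _ _ _ JX T UT ε U V π y₀ z₀ hUT hT hTJ hε hU hUs hUinj hN hπ _ hπU hπV _ hy₀ hz₀ hT0
    hderiv
  have h0 : ‖(0 : ℂ)‖ < ε := by simpa using hε
  have hy₀N : y₀ ∈ ⋃ a ∈ Metric.ball (0 : ℂ) ε, (range (U a) ∪ {V a 0}) :=
    mem_iUnion₂.2 ⟨0, Metric.mem_ball_self hε, hy₀⟩
  have hπy₀ : π y₀ = 0 := by
    rcases hy₀ with ⟨z, rfl⟩ | h
    · exact hπU 0 h0 z
    · rw [mem_singleton_iff.1 h]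
      exact hπV 0 h0 0
  exact LamLocal.exists_local_representative JX hUT hT hTJ hε (hU 0 h0).1 (hU 0 h0).2 hUs hUinj hN
    hπ hy₀N hπy₀ hz₀ hT0 hderiv

/-- **Local smooth representative of the retraction `lam`, `V`-chart.**  The mirror image of
`helper_lamLocalU` at a simple zero of `T ∘ V 0` at `w = 0` (`V 0 0 ∈ UT`, `T (V 0 0) = 0`,
`deriv (T ∘ V 0) 0 ≠ 0`): near every point `y₀` of the leaf `0` there are an open `O ∋ y₀`,
`O ⊆ N`, and `ℓ : X → X` smooth on `O` with `ℓ y ∈ UT`, `T (ℓ y) = 0`, `ℓ y = V (π y) w` for some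
`w`, and `dℓ_y ξ = 0 ↔ dπ_y ξ = 0`. -/
theorem helper_lamLocalV : ∀ (X : Type) [TopologicalSpace X] [T2Space X] [SecondCountableTopology X] [ChartedSpace (EuclideanSpace ℝ (Fin 4)) X] [IsManifold (𝓡 4) ∞ X] (JX : ∀ y : X, TangentSpace (𝓡 4) y →L[ℝ] TangentSpace (𝓡 4) y) (T : X → ℂ) (UT : Set X) (ε : ℝ) (U V : ℂ → ℂ → X) (π : X → ℂ) (y₀ : X), IsOpen UT → ContMDiffOn (𝓡 4) 𝓘(ℝ, ℂ) ∞ T UT → (∀ y ∈ UT, ∀ w : TangentSpace (𝓡 4) y, (show ℂ from mfderiv (𝓡 4) 𝓘(ℝ, ℂ) T y (JX y w)) = Complex.I * (show ℂ from mfderiv (𝓡 4) 𝓘(ℝ, ℂ) T y w)) → 0 < ε → (∀ a : ℂ, ‖a‖ < ε → ContMDiff 𝓘(ℝ, ℂ) (𝓡 4) ∞ (V a) ∧ IsJHolomorphic (𝓡 4) JX (V a)) → ContMDiffOn 𝓘(ℝ, ℂ × ℂ) (𝓡 4) ∞ (fun q : ℂ × ℂ => V q.1 q.2) (Metric.ball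 0 ε ×ˢ univ) → (∀ q ∈ Metric.ball (0 : ℂ) ε ×ˢ (univ : Set ℂ), Injective (mfderiv 𝓘(ℝ, ℂ × ℂ) (𝓡 4) (fun q : ℂ × ℂ => V q.1 q.2) q)) → IsOpen (⋃ a ∈ Metric.ball (0 : ℂ) ε, (range (U a) ∪ {V a 0})) → ContMDiffOn (𝓡 4) 𝓘(ℝ, ℂ) ∞ π (⋃ a ∈ Metric.ball (0 : ℂ) ε, (range (U a) ∪ {V a 0})) → (∀ y ∈ ⋃ a ∈ Metric.ball (0 : ℂ) ε, (range (U a) ∪ {V a 0}), Surjective (mfderiv (𝓡 4) 𝓘(ℝ, ℂ) π y)) → (∀ a : ℂ, ‖a‖ < ε → ∀ z : ℂ, π (U a z) = a) → (∀ a : ℂ, ‖a‖ < ε → ∀ w : ℂ, π (V a w) = a) → (∀ y ∈ ⋃ a ∈ Metric.ball (0 : ℂ) ε, (range (U a) ∪ {V a 0}), ‖π y‖ < ε) → y₀ ∈ range (U 0) ∪ {V 0 0} → V 0 0 ∈ UT → T (V 0 0) = 0 → deriv (T ∘ V 0) 0 ≠ 0 → ∃ (O : Set X) (ℓ : X → X),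 IsOpen O ∧ y₀ ∈ O ∧ O ⊆ (⋃ a ∈ Metric.ball (0 : ℂ) ε, (range (U a) ∪ {V a 0})) ∧ ContMDiffOn (𝓡 4) (𝓡 4) ∞ ℓ O ∧ (∀ y ∈ O, ℓ y ∈ UT ∧ T (ℓ y) = 0 ∧ ∃ w : ℂ, ℓ y = V (π y) w) ∧ (∀ y ∈ O, ∀ ξ : TangentSpace (𝓡 4) y, mfderiv (𝓡 4) (𝓡 4) ℓ y ξ = 0 ↔ mfderiv (𝓡 4) 𝓘(ℝ, ℂ) π y ξ = 0) := by
  intro X _ _ _ _ _ JX T UT ε U V π y₀ hUT hT hTJ hε hV hVs hVinj hN hπ _ hπU hπV _ hy₀ hz₀ hT0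
    hderiv
  have h0 : ‖(0 : ℂ)‖ < ε := by simpa using hε
  have hy₀N : y₀ ∈ ⋃ a ∈ Metric.ball (0 : ℂ) ε, (range (U a) ∪ {V a 0}) :=
    mem_iUnion₂.2 ⟨0, Metric.mem_ball_self hε, hy₀⟩
  have hπy₀ : π y₀ = 0 := by
    rcases hy₀ with ⟨z, rfl⟩ | h
    · exact hπU 0 h0 z
    · rw [mem_singleton_iff.1 h]
      exact hπV 0 h0 0
  exact LamLocal.exists_local_representative JX hUT hT hTJ hε (hV 0 h0).1 (hV 0 h0).2 hVs hVinj hN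
    hπ hy₀N hπy₀ hz₀ hT0 hderiv

end Summit.SmoothPoincare4.SmoothPoincare4.Theorems.GromovRecognitionRelEnd.CrossCapLaurent
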